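import Mathlib.NumberTheory.Chebyshev
import Mathlib.NumberTheory.ArithmeticFunction.Misc
import Mathlib.NumberTheory.ArithmeticFunction.VonMangoldt
import Mathlib.Data.Nat.Factorization.PrimePow
import Mathlib.Analysis.Complex.ExponentialBounds
import Literature.NumberTheory.LFunctions.ChebyshevSylvesterPsi
import Literature.NumberTheory.LFunctions.RosserSchoenfeldMertensFirstProofs
import Literature.NumberTheory.LFunctions.SchoenfeldPsiSmall
import HarnessLib

/-!
# The sharp Helson potential `log m + ψ₁(M/m) ≤ log M` and stub `stub_helsonG`
(crux `WeilComb.CombShapePositivity`, item stmt-RiemannHypothesis-11229, line `Sketch`; siege k7)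

The line's Helson potential is `V(m) = log m + ψ₁(M/m)`, `ψ₁(y) = Σ_{n ≤ y} Λ(n)/n`; the
registered stub `stub_helsonG` asks for `V ≤ log M + 39/50`. This file proves the SHARP bound
`V(m) ≤ log M` — constant `G = 0`, attained at `m = M` (`log_add_sum_vonMangoldt_div_self`),
hence optimal — i.e. the Mertens–Chebyshev inequality (`sum_vonMangoldt_div_le_log`)

  `Σ_{n ≤ N} Λ(n)/n ≤ log N`  for every natural `N ≥ 1`, with equality at `N = 1`

(the tree had `< log x + 1`, `RosserSchoenfeld.sum_vonMangoldt_div_lt_log_add_one`; the three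
earlier proofs of this stub give `39/50` or `log 4 − 1`). The gain `39/50 → 0` enters the line's
budget `log(1/λ) ≥ (1 + log 4) + G + …` (`stub_assemble40`) one for one; the sharp (`G = 0`)
Helson inequality is `sum_norm_sq_mul_potential_le`, and `stub_helsonG` follows a fortiori.

Proof. Analytic range `N ≥ 17`: with `h = ⌊N/2⌋`, Chebyshev's identity
`log N! = Σ_{n ≤ N} Λ(n)⌊N/n⌋` (the tree's `Sylvester.T_eq_sum`) gives
`N ψ₁(N) − log N! = Σ_{n ≤ N} Λ(n){N/n} ≤ ψ(h) + Σ_{h < n ≤ N} Λ(n)(N/n − 1)`. The new point is the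
hyperbolic tail: by Abel summation (`tail_abel`), whenever `ψ(k) ≤ c k`,
`Σ_{h < n ≤ N} Λ(n)(N/n − 1) = Σ_{h < k < N} N(ψ(k) − ψ(h))/(k(k+1))
  ≤ c N (H_N − H_{h+1}) − ψ(h)(N/(h+1) − 1)`,
and the two `ψ(h)` terms CANCEL up to `ψ(h)(2 − N/(h+1)) ≤ 2c`: `N ψ₁(N) ≤ log N! + c N log 2 + 2c`
(`natCast_mul_sum_vonMangoldt_div_le`). With Stirling (`RosserSchoenfeld324.log_factorial_le`)
this is `≤ N log N` once `(log N)/2 + 1 + 2c ≤ (1 − c log 2) N`: from `N ≥ 17` for `c = 1.04`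
(`ψ ≤ 1.04 x` on `[0, 10⁴]`, Rosser–Schoenfeld 1962 Thm. 12 as tabulated in the tree,
`SchoenfeldBound.psi_le_of_le_ten_thousand`), from `N ≥ 25` for `c = 1.15` (Sylvester's
`ψ ≤ 1.0722 x + 7 √x`, `psi_le_sylvester`, used beyond `10⁴`). Finite range `N ≤ 16`: five blocks,
`Λ(1), …, Λ(16)` explicit, logs in units of `log 2`. Mathlib + three sorry-free Literature files.
-/

noncomputable section

-- the sub-problem path RiemannHypothesis/RiemannHypothesis duplicates a namespace (D-0017)
set_option linter.dupNamespace false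

open scoped Chebyshev
open Finset ArithmeticFunction

namespace Summit.RiemannHypothesis.RiemannHypothesis.Theorems.WeilCombHelsonGK7

open Literature.NumberTheory.LFunctions RosserSchoenfeld324

/-- Chebyshev's identity `log N! = Σ_{n ≤ N} Λ(n) ⌊N/n⌋` (`Λ * ζ = log`), through the tree's
`Sylvester.T N = Σ_{m ≤ N} log m` and `Sylvester.T_eq_sum`. [folklore] -/
theorem log_factorial_eq_sum_vonMangoldt_mul_div (N : ℕ) :
    Real.log (N.factorial : ℝ) = ∑ n ∈ Ioc 0 N, Λ n * ((N / n : ℕ) : ℝ) := by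
  rw [← Sylvester.T_eq_sum]
  induction N with
  | zero => simp [Sylvester.T]
  | succ k ih =>
    rw [Sylvester.T_succ, ← ih, Nat.factorial_succ, Nat.cast_mul,
      Real.log_mul (by positivity) (by positivity)]
    push_cast
    ring

/-- `Σ_{h < n ≤ k} Λ(n) = ψ(k) − ψ(h)` for `h ≤ k` (`ψ(k) = Σ_{n ≤ k} Λ(n)`). [folklore] -/
theorem sum_Ioc_vonMangoldt_eq_psi_sub {h k : ℕ} (hk : h ≤ k) :
    ∑ n ∈ Ioc h k, Λ n = ψ (k : ℝ) - ψ (h : ℝ) := by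
  simp only [Chebyshev.psi, Nat.floor_natCast, ← Finset.sum_Ioc_consecutive _ (Nat.zero_le h) hk]
  ring

/-- The telescoping harmonic bound `Σ_{m < k ≤ n} 1/k ≤ log n − log m` for `1 ≤ m ≤ n`
(`1/k ≤ log k − log(k−1)`). [folklore] -/
theorem sum_Ioc_one_div_le_log_sub_log {m : ℕ} (hm : 1 ≤ m) :
    ∀ n : ℕ, m ≤ n → ∑ k ∈ Ioc m n, (1 : ℝ) / k ≤ Real.log n - Real.log m := by
  intro n hn
  induction n, hn using Nat.le_induction with
  | base => simp
  | succ n hmn ih =>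
    rw [Finset.sum_Ioc_succ_top hmn]
    have hn0 : (0 : ℝ) < n := by exact_mod_cast lt_of_lt_of_le Nat.zero_lt_one (hm.trans hmn)
    have hn1 : (0 : ℝ) < (n : ℝ) + 1 := by linarith
    have h := Real.one_sub_inv_le_log_of_pos (show (0 : ℝ) < ((n : ℝ) + 1) / n by positivity)
    rw [Real.log_div hn1.ne' hn0.ne', inv_div] at h
    have he : (1 : ℝ) - n / (n + 1) = 1 / (n + 1) := by field_simp; ring
    push_cast at h ⊢
    linarith

/-- **Hyperbolic-tail Abel summation.** If `h + 1 ≤ N`, `X ≥ 0`, `ψ(k) ≤ c k` (`h < k < N`):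
`Σ_{h < n ≤ N} Λ(n) (X/n − X/N) ≤ c X Σ_{h+1 < k ≤ N} 1/k − ψ(h) X (1/(h+1) − 1/N)`
(induction on `N`: the increment from `N` to `N + 1` is `(X/N − X/(N+1)) (ψ(N) − ψ(h))`,
and `ψ(N) ≤ c N`). [folklore] -/
theorem tail_abel (h : ℕ) {c X : ℝ} (hX : 0 ≤ X) :
    ∀ N : ℕ, h + 1 ≤ N → (∀ k : ℕ, h < k → k < N → ψ (k : ℝ) ≤ c * k) →
      ∑ n ∈ Ioc h N, Λ n * (X / n - X / N) ≤
        c * X * ∑ k ∈ Ioc (h + 1) N, (1 : ℝ) / k -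
          ψ (h : ℝ) * X * (1 / ((h : ℝ) + 1) - 1 / N) := by
  intro N hN
  induction N, hN using Nat.le_induction with
  | base => intro _; simp [Nat.Ioc_succ_singleton]
  | succ N hN ih =>
    intro hψ
    have ih' := ih fun k hk hkN => hψ k hk (Nat.lt_succ_of_lt hkN)
    have hN0 : (0 : ℝ) < N := by exact_mod_cast lt_of_lt_of_le (Nat.succ_pos h) hN
    have hhN : h ≤ N := by omega
    rw [Finset.sum_Ioc_succ_top hhN, Finset.sum_Ioc_succ_top hN]
    push_cast
    set d : ℝ := X / N - X / ((N : ℝ) + 1) with hd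
    have hd0 : 0 ≤ d := by
      rw [hd, sub_nonneg]
      exact div_le_div_of_nonneg_left hX hN0 (by linarith)
    have hdN : d * N = X * (1 / ((N : ℝ) + 1)) := by rw [hd]; field_simp; ring
    have hsplit : ∑ n ∈ Ioc h N, Λ n * (X / n - X / ((N : ℝ) + 1)) =
        ∑ n ∈ Ioc h N, Λ n * (X / n - X / N) + d * ∑ n ∈ Ioc h N, Λ n := by
      rw [Finset.mul_sum, ← Finset.sum_add_distrib]
      exact Finset.sum_congr rfl fun n _ => by rw [hd]; ring
    have hψN : ψ (N : ℝ) ≤ c * N := hψ N (by omega) (Nat.lt_succ_self N)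
    have hstep :
        d * ∑ n ∈ Ioc h N, Λ n ≤ c * (X * (1 / ((N : ℝ) + 1))) - d * ψ (h : ℝ) := by
      rw [sum_Ioc_vonMangoldt_eq_psi_sub hhN]
      have h1 : d * (ψ (N : ℝ) - ψ (h : ℝ)) ≤ d * (c * N - ψ (h : ℝ)) :=
        mul_le_mul_of_nonneg_left (by linarith) hd0
      have h2 : d * (c * N - ψ (h : ℝ)) = c * (d * N) - d * ψ (h : ℝ) := by ring
      rw [h2, hdN] at h1
      exact h1
    have htop : Λ (N + 1) * (X / ((N : ℝ) + 1) - X / ((N : ℝ) + 1)) = 0 := by ring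
    have hd' : ψ (h : ℝ) * X * (1 / ((h : ℝ) + 1) - 1 / ((N : ℝ) + 1)) =
        ψ (h : ℝ) * X * (1 / ((h : ℝ) + 1) - 1 / N) + d * ψ (h : ℝ) := by rw [hd]; ring
    rw [hsplit, htop, hd']
    linarith [ih', hstep]

/-- **The hyperbolic-tail estimate.** For `N ≥ 1`, `c ≥ 0` and `ψ(k) ≤ c k` for all `k < N`:
`N Σ_{n ≤ N} Λ(n)/n ≤ log N! + c N log 2 + 2c` (`h = ⌊N/2⌋`; Chebyshev's identity leaves
`Σ_{n ≤ N} Λ(n){N/n} ≤ ψ(h) + Σ_{h < n ≤ N} Λ(n)(N/n − 1)`; `tail_abel` bounds the tail by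
`c N (H_N − H_{h+1}) − ψ(h)(N/(h+1) − 1)`; `ψ(h)(2 − N/(h+1)) ≤ c h (2 − N/(h+1)) ≤ 2c` and
`H_N − H_{h+1} ≤ log(N/(h+1)) ≤ log 2`). [folklore] -/
theorem natCast_mul_sum_vonMangoldt_div_le (N : ℕ) (hN : 1 ≤ N) {c : ℝ} (hc : 0 ≤ c)
    (hψ : ∀ k : ℕ, k < N → ψ (k : ℝ) ≤ c * k) :
    (N : ℝ) * ∑ n ∈ Ioc 0 N, Λ n / n ≤
      Real.log (N.factorial : ℝ) + c * N * Real.log 2 + 2 * c := by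
  set h := N / 2 with hh
  have hhN : h < N := by omega
  have h2h : 2 * h ≤ N := by omega
  have hN2 : N ≤ 2 * (h + 1) := by omega
  have hN0 : (0 : ℝ) < N := by exact_mod_cast (by omega : 0 < N)
  have e2 : (N : ℝ) * ∑ n ∈ Ioc 0 N, Λ n / n - Real.log (N.factorial : ℝ) =
      ∑ n ∈ Ioc 0 N, Λ n * ((N : ℝ) / n - ((N / n : ℕ) : ℝ)) := by
    rw [log_factorial_eq_sum_vonMangoldt_mul_div N, Finset.mul_sum, ← Finset.sum_sub_distrib]
    exact Finset.sum_congr rfl fun n _ => by ring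
  have hsplit := Finset.sum_Ioc_consecutive
    (fun n => Λ n * ((N : ℝ) / n - ((N / n : ℕ) : ℝ))) (Nat.zero_le h) hhN.le
  -- head `n ≤ h`: `{N/n} ≤ 1`
  have hhead : ∑ n ∈ Ioc 0 h, Λ n * ((N : ℝ) / n - ((N / n : ℕ) : ℝ)) ≤ ψ (h : ℝ) := by
    rw [Chebyshev.psi, Nat.floor_natCast]
    refine Finset.sum_le_sum fun n hn => ?_
    have hn0 : 0 < n := (Finset.mem_Ioc.1 hn).1
    have hfl := sub_one_le_natDiv N n hn0
    have h1 : (N : ℝ) / n - ((N / n : ℕ) : ℝ) ≤ 1 := by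
      have hadd : ((N : ℝ) + 1) / n = (N : ℝ) / n + 1 / n := by rw [add_div]
      linarith [show 0 ≤ 1 / (n : ℝ) by positivity]
    calc Λ n * ((N : ℝ) / n - ((N / n : ℕ) : ℝ)) ≤ Λ n * 1 :=
          mul_le_mul_of_nonneg_left h1 vonMangoldt_nonneg
      _ = Λ n := mul_one _
  -- tail `h < n ≤ N`: `⌊N/n⌋ ≥ 1`, then `tail_abel` with `X = N`
  have htail1 : ∑ n ∈ Ioc h N, Λ n * ((N : ℝ) / n - ((N / n : ℕ) : ℝ)) ≤
      ∑ n ∈ Ioc h N, Λ n * ((N : ℝ) / n - (N : ℝ) / N) := by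
    refine Finset.sum_le_sum fun n hn => ?_
    have hn' := Finset.mem_Ioc.1 hn
    have h1 : (1 : ℝ) ≤ ((N / n : ℕ) : ℝ) := by
      exact_mod_cast Nat.div_pos hn'.2 (by omega)
    rw [div_self hN0.ne']
    exact mul_le_mul_of_nonneg_left (by linarith) vonMangoldt_nonneg
  have htail2 := tail_abel h (Nat.cast_nonneg N) N hhN (fun k _ hk => hψ k hk)
  -- harmonic tail `≤ log 2`
  have hharm : ∑ k ∈ Ioc (h + 1) N, (1 : ℝ) / k ≤ Real.log 2 := by
    have h1 := sum_Ioc_one_div_le_log_sub_log (Nat.succ_pos h) N hhN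
    have h2 : Real.log N ≤ Real.log 2 + Real.log ((h + 1 : ℕ) : ℝ) := by
      rw [← Real.log_mul two_ne_zero (by positivity)]
      exact Real.log_le_log hN0 (by exact_mod_cast hN2)
    linarith
  have hψh : ψ (h : ℝ) ≤ c * h := hψ h hhN
  set r : ℝ := (N : ℝ) / ((h : ℝ) + 1) with hr
  have hh0 : (0 : ℝ) < (h : ℝ) + 1 := by positivity
  have hr2 : r ≤ 2 := by
    rw [hr, div_le_iff₀ hh0]
    have h' : ((N : ℕ) : ℝ) ≤ ((2 * (h + 1) : ℕ) : ℝ) := by exact_mod_cast hN2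
    push_cast at h'
    linarith
  have hhr : (h : ℝ) * (2 - r) ≤ 2 := by
    have h2h' : (2 : ℝ) * h ≤ N := by exact_mod_cast h2h
    have hh0' : (0 : ℝ) ≤ h := Nat.cast_nonneg h
    have : (2 : ℝ) * h - 2 ≤ h * r := by
      rw [hr, mul_div_assoc', le_div_iff₀ hh0]
      nlinarith
    linarith
  have hu : (N : ℝ) * (1 / ((h : ℝ) + 1) - 1 / N) = r - 1 := by rw [hr]; field_simp
  have key1 : ψ (h : ℝ) * (2 - r) ≤ c * h * (2 - r) :=
    mul_le_mul_of_nonneg_right hψh (by linarith)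
  have key2 : c * (h * (2 - r)) ≤ c * 2 := mul_le_mul_of_nonneg_left hhr hc
  have key3 : c * N * ∑ k ∈ Ioc (h + 1) N, (1 : ℝ) / k ≤ c * N * Real.log 2 :=
    mul_le_mul_of_nonneg_left hharm (by positivity)
  rw [mul_assoc (ψ (h : ℝ)) (N : ℝ), hu] at htail2
  nlinarith [e2, hsplit, hhead, htail1, htail2, key1, key2, key3]

/-- **`Σ_{n ≤ N} Λ(n)/n ≤ log N` for `N ≥ 17`** (analytic range): `ψ(k) ≤ 1.04 k` for
`k ≤ 10⁴` (`SchoenfeldBound.psi_le_of_le_ten_thousand`), `ψ(k) ≤ 1.15 k` beyond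
(`psi_le_sylvester`), Stirling `log N! ≤ N log N − N + (log N)/2 + 1`,
`log N ≤ log 17 − 1 + N/17` (`17^4 ≤ 2^17`), and `(log N)/2 + 1 + 2c + c N log 2 ≤ N`.
[folklore] -/
theorem sum_vonMangoldt_div_le_log_of_seventeen_le (N : ℕ) (h17 : 17 ≤ N) :
    ∑ n ∈ Ioc 0 N, Λ n / n ≤ Real.log N := by
  have hN0 : (0 : ℝ) < N := by exact_mod_cast (by omega : 0 < N)
  have hN17 : (17 : ℝ) ≤ N := by exact_mod_cast h17
  have hstir := log_factorial_le N (by omega)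
  have hL := Real.log_two_lt_d9
  have hlogN : Real.log N ≤ 1.946 + (N : ℝ) / 17 := by
    have h1 := Real.log_le_sub_one_of_pos (show (0 : ℝ) < (N : ℝ) / 17 by positivity)
    rw [Real.log_div hN0.ne' (by norm_num)] at h1
    have h17' : (4 : ℝ) * Real.log 17 ≤ 17 * Real.log 2 := by exact_mod_cast pow_log_le 17 4 2 17
    linarith
  have hNL : (N : ℝ) * Real.log 2 ≤ N * 0.6931471808 := mul_le_mul_of_nonneg_left hL.le hN0.le
  refine le_of_mul_le_mul_left ?_ hN0
  rcases le_or_gt N 10000 with hsmall | hbig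
  · have hψ : ∀ k : ℕ, k < N → ψ (k : ℝ) ≤ 1.04 * k := fun k hk =>
      SchoenfeldBound.psi_le_of_le_ten_thousand (Nat.cast_nonneg k)
        (by exact_mod_cast (hk.le.trans hsmall))
    have key := natCast_mul_sum_vonMangoldt_div_le N (by omega) (by norm_num) hψ
    nlinarith [key, hstir, hlogN, hNL]
  · -- `ψ(k) ≤ 1.15 k` for every `k` (`1.04` up to `10⁴`, Sylvester beyond)
    have hψ : ∀ k : ℕ, k < N → ψ (k : ℝ) ≤ 1.15 * k := by
      intro k _
      have hk : (0 : ℝ) ≤ k := Nat.cast_nonneg k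
      rcases le_or_gt (k : ℝ) 10000 with h | h
      · linarith [SchoenfeldBound.psi_le_of_le_ten_thousand hk h]
      · have hs : Real.sqrt k ≤ k / 100 := by
          rw [Real.sqrt_le_iff]
          exact ⟨by positivity, by nlinarith⟩
        linarith [psi_le_sylvester hk]
    have key := natCast_mul_sum_vonMangoldt_div_le N (by omega) (by norm_num) hψ
    have hbig' : (10000 : ℝ) < N := by exact_mod_cast hbig
    nlinarith [key, hstir, hlogN, hNL, hbig']

/-- `Λ(n) = 0` if `n` has two distinct prime divisors (not a prime power). [folklore] -/
theorem vonMangoldt_eq_zero_of_two_primes {n p q : ℕ} (hp : p.Prime) (hq : q.Prime)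
    (hpq : p ≠ q) (hpn : p ∣ n) (hqn : q ∣ n) : Λ n = 0 :=
  vonMangoldt_eq_zero_iff.2 fun h =>
    hpq ((isPrimePow_iff_unique_prime_dvd.1 h).unique ⟨hp, hpn⟩ ⟨hq, hqn⟩)

/-- One step of the partial sums: `Σ_{k ≤ n+1} Λ(k)/k = Σ_{k ≤ n} Λ(k)/k + Λ(n+1)/(n+1)`.
[folklore] -/
theorem sum_vonMangoldt_div_succ (n m : ℕ) (hm : n + 1 = m) :
    ∑ k ∈ Ioc 0 m, Λ k / k = ∑ k ∈ Ioc 0 n, Λ k / k + Λ m / m := by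
  subst hm
  exact Finset.sum_Ioc_succ_top (Nat.zero_le n) _

/-- Monotonicity of the partial sums `Σ_{k ≤ n} Λ(k)/k` (nonnegative terms). [folklore] -/
theorem sum_vonMangoldt_div_mono {a b : ℕ} (hab : a ≤ b) :
    ∑ k ∈ Ioc 0 a, Λ k / k ≤ ∑ k ∈ Ioc 0 b, Λ k / k :=
  Finset.sum_le_sum_of_subset_of_nonneg (Finset.Ioc_subset_Ioc_right hab)
    fun k _ _ => div_nonneg vonMangoldt_nonneg (Nat.cast_nonneg k)

/-- **`Σ_{n ≤ N} Λ(n)/n ≤ log N` for `1 ≤ N ≤ 16`** (five blocks `{1}, {2}, [3,4], [5,8],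
[9,16]`: the partial sum at the top of each block, with `Λ` evaluated at `1, …, 16` and the logs in
units of `log 2` via `3^17 ≤ 2^27`, `5^31 ≤ 2^72`, `7^26 ≤ 2^73`, `11^13 ≤ 2^45`, `13^7 ≤ 2^26`,
is below `log q` at the bottom `q` via `2^19 ≤ 3^12`, `2^16 ≤ 5^7`; equality at `N = 1`).
[folklore] -/
theorem sum_vonMangoldt_div_le_log_of_le_sixteen (N : ℕ) (h1 : 1 ≤ N) (h16 : N ≤ 16) :
    ∑ n ∈ Ioc 0 N, Λ n / n ≤ Real.log N := by
  -- values of `Λ` at `1, …, 16`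
  have v1 : Λ 1 = 0 := vonMangoldt_apply_one
  have v2 : Λ 2 = Real.log 2 := by exact_mod_cast vonMangoldt_apply_prime Nat.prime_two
  have v3 : Λ 3 = Real.log 3 := by exact_mod_cast vonMangoldt_apply_prime Nat.prime_three
  have v5 : Λ 5 = Real.log 5 := by exact_mod_cast vonMangoldt_apply_prime Nat.prime_five
  have v7 : Λ 7 = Real.log 7 := by exact_mod_cast vonMangoldt_apply_prime (by norm_num)
  have v11 : Λ 11 = Real.log 11 := by exact_mod_cast vonMangoldt_apply_prime (by norm_num)
  have v13 : Λ 13 = Real.log 13 := by exact_mod_cast vonMangoldt_apply_prime (by norm_num)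
  have v4 : Λ 4 = Real.log 2 := by
    rw [show (4 : ℕ) = 2 ^ 2 by norm_num, vonMangoldt_apply_pow two_ne_zero, v2]
  have v8 : Λ 8 = Real.log 2 := by
    rw [show (8 : ℕ) = 2 ^ 3 by norm_num, vonMangoldt_apply_pow three_ne_zero, v2]
  have v9 : Λ 9 = Real.log 3 := by
    rw [show (9 : ℕ) = 3 ^ 2 by norm_num, vonMangoldt_apply_pow two_ne_zero, v3]
  have v16 : Λ 16 = Real.log 2 := by
    rw [show (16 : ℕ) = 2 ^ 4 by norm_num, vonMangoldt_apply_pow four_ne_zero, v2]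
  have Z := @vonMangoldt_eq_zero_of_two_primes
  have p7 : Nat.Prime 7 := by norm_num
  have v6 : Λ 6 = 0 := @Z 6 2 3 Nat.prime_two Nat.prime_three (by decide) ⟨3, rfl⟩ ⟨2, rfl⟩
  have v10 : Λ 10 = 0 := @Z 10 2 5 Nat.prime_two Nat.prime_five (by decide) ⟨5, rfl⟩ ⟨2, rfl⟩
  have v12 : Λ 12 = 0 := @Z 12 2 3 Nat.prime_two Nat.prime_three (by decide) ⟨6, rfl⟩ ⟨4, rfl⟩
  have v14 : Λ 14 = 0 := @Z 14 2 7 Nat.prime_two p7 (by decide) ⟨7, rfl⟩ ⟨2, rfl⟩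
  have v15 : Λ 15 = 0 := @Z 15 3 5 Nat.prime_three Nat.prime_five (by decide) ⟨5, rfl⟩ ⟨3, rfl⟩
  -- the chain of partial sums `S(m) = S(m−1) + Λ(m)/m`
  have e0 : ∑ k ∈ Ioc 0 0, Λ k / k = 0 := by simp
  have e1 := sum_vonMangoldt_div_succ 0 1 rfl; have e2 := sum_vonMangoldt_div_succ 1 2 rfl
  have e3 := sum_vonMangoldt_div_succ 2 3 rfl; have e4 := sum_vonMangoldt_div_succ 3 4 rfl
  have e5 := sum_vonMangoldt_div_succ 4 5 rfl; have e6 := sum_vonMangoldt_div_succ 5 6 rfl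
  have e7 := sum_vonMangoldt_div_succ 6 7 rfl; have e8 := sum_vonMangoldt_div_succ 7 8 rfl
  have e9 := sum_vonMangoldt_div_succ 8 9 rfl; have e10 := sum_vonMangoldt_div_succ 9 10 rfl
  have e11 := sum_vonMangoldt_div_succ 10 11 rfl; have e12 := sum_vonMangoldt_div_succ 11 12 rfl
  have e13 := sum_vonMangoldt_div_succ 12 13 rfl; have e14 := sum_vonMangoldt_div_succ 13 14 rfl
  have e15 := sum_vonMangoldt_div_succ 14 15 rfl; have e16 := sum_vonMangoldt_div_succ 15 16 rfl
  rw [v1] at e1; rw [v2] at e2; rw [v3] at e3; rw [v4] at e4; rw [v5] at e5; rw [v6] at e6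
  rw [v7] at e7; rw [v8] at e8; rw [v9] at e9; rw [v10] at e10; rw [v11] at e11
  rw [v12] at e12; rw [v13] at e13; rw [v14] at e14; rw [v15] at e15; rw [v16] at e16
  push_cast at e1 e2 e3 e4 e5 e6 e7 e8 e9 e10 e11 e12 e13 e14 e15 e16
  -- logarithms in units of `log 2`
  have hL := Real.log_two_gt_d9
  have u3 : (17 : ℝ) * Real.log 3 ≤ 27 * Real.log 2 := by exact_mod_cast pow_log_le 3 17 2 27
  have u5 : (31 : ℝ) * Real.log 5 ≤ 72 * Real.log 2 := by exact_mod_cast pow_log_le 5 31 2 72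
  have u7 : (26 : ℝ) * Real.log 7 ≤ 73 * Real.log 2 := by exact_mod_cast pow_log_le 7 26 2 73
  have u11 : (13 : ℝ) * Real.log 11 ≤ 45 * Real.log 2 := by exact_mod_cast pow_log_le 11 13 2 45
  have u13 : (7 : ℝ) * Real.log 13 ≤ 26 * Real.log 2 := by exact_mod_cast pow_log_le 13 7 2 26
  have l3 : (19 : ℝ) * Real.log 2 ≤ 12 * Real.log 3 := by exact_mod_cast pow_log_le 2 19 3 12
  have l5 : (16 : ℝ) * Real.log 2 ≤ 7 * Real.log 5 := by exact_mod_cast pow_log_le 2 16 5 7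
  -- `log q ≤ log N` for `0 < q ≤ N`
  have hq : ∀ q : ℕ, 0 < q → q ≤ N → Real.log q ≤ Real.log N := fun q hq0 hqN =>
    Real.log_le_log (by exact_mod_cast hq0) (by exact_mod_cast hqN)
  rcases (by omega : N = 1 ∨ N = 2 ∨ (3 ≤ N ∧ N ≤ 4) ∨ (5 ≤ N ∧ N ≤ 8) ∨ (9 ≤ N ∧ N ≤ 16))
    with rfl | rfl | ⟨ha, hb⟩ | ⟨ha, hb⟩ | ⟨ha, hb⟩
  · rw [e1, e0]; push_cast; simp
  · push_cast; linarith
  · have hm := sum_vonMangoldt_div_mono hb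
    have hl := hq 3 (by norm_num) ha; push_cast at hl
    linarith
  · have hm := sum_vonMangoldt_div_mono hb
    have hl := hq 5 (by norm_num) ha; push_cast at hl
    linarith
  · have hm := sum_vonMangoldt_div_mono hb
    have hl := hq 9 (by norm_num) ha; push_cast at hl
    have h9 : Real.log 9 = 2 * Real.log 3 := by
      rw [show (9 : ℝ) = 3 ^ 2 by norm_num, Real.log_pow]; norm_num
    linarith

/-- **The sharp Mertens–Chebyshev bound `Σ_{n ≤ N} Λ(n)/n ≤ log N` for every natural
`N ≥ 1`** (equality at `N = 1`; the true value is `log N − γ + o(1)`). The constant `0` replaces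
the `+1` of `RosserSchoenfeld.sum_vonMangoldt_div_lt_log_add_one` and the `39/50` of the line's
budget. [folklore] -/
theorem sum_vonMangoldt_div_le_log (N : ℕ) (hN : 1 ≤ N) :
    ∑ n ∈ Finset.Icc 1 N, (Λ n : ℝ) / n ≤ Real.log N := by
  rw [show Finset.Icc 1 N = Finset.Ioc 0 N from Finset.Icc_add_one_left_eq_Ioc 0 N]
  rcases le_or_gt N 16 with h | h
  · exact sum_vonMangoldt_div_le_log_of_le_sixteen N hN h
  · exact sum_vonMangoldt_div_le_log_of_seventeen_le N (by omega)

/-- **The sharp Helson potential**: for `1 ≤ m ≤ M`, `log m + Σ_{n ≤ M/m} Λ(n)/n ≤ log M`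
(`Σ_{n ≤ ⌊M/m⌋} Λ(n)/n ≤ log ⌊M/m⌋` and `m ⌊M/m⌋ ≤ M`). [folklore] -/
theorem log_add_sum_vonMangoldt_div_le_log {M m : ℕ} (hm : m ∈ Finset.Icc 1 M) :
    Real.log m + ∑ n ∈ Finset.Icc 1 (M / m), (Λ n : ℝ) / n ≤ Real.log M := by
  obtain ⟨hm1, hmM⟩ := Finset.mem_Icc.1 hm
  have hq : 1 ≤ M / m := (Nat.le_div_iff_mul_le hm1).2 (by simpa using hmM)
  have h := sum_vonMangoldt_div_le_log (M / m) hq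
  have hm0 : (0 : ℝ) < m := by exact_mod_cast hm1
  have hq0 : (0 : ℝ) < ((M / m : ℕ) : ℝ) := by exact_mod_cast hq
  have hprod : (m : ℝ) * ((M / m : ℕ) : ℝ) ≤ M := by exact_mod_cast Nat.mul_div_le M m
  have hlog : Real.log m + Real.log ((M / m : ℕ) : ℝ) ≤ Real.log M := by
    rw [← Real.log_mul hm0.ne' hq0.ne']
    exact Real.log_le_log (by positivity) hprod
  linarith

/-- The potential bound is attained at `m = M`: `log M + Σ_{n ≤ M/M} Λ(n)/n = log M`
(`M ≥ 1`), so the constant `0` in `log_add_sum_vonMangoldt_div_le_log` is optimal. [folklore] -/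
theorem log_add_sum_vonMangoldt_div_self {M : ℕ} (hM : 1 ≤ M) :
    Real.log M + ∑ n ∈ Finset.Icc 1 (M / M), (Λ n : ℝ) / n = Real.log M := by
  rw [Nat.div_self hM, Finset.Icc_self, Finset.sum_singleton, vonMangoldt_apply_one]
  simp

/-- **The sharp (`G = 0`) Helson inequality**: for every `M` and `a : ℕ → ℂ`,
`Σ_{m ≤ M} ‖a_m‖² (log m + ψ₁(M/m)) ≤ log M · Σ_{m ≤ M} ‖a_m‖²`, `ψ₁(y) = Σ_{n ≤ y} Λ(n)/n`,
with equality for `a = δ_M`. [folklore] -/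
theorem sum_norm_sq_mul_potential_le (M : ℕ) (a : ℕ → ℂ) :
    ∑ m ∈ Finset.Icc 1 M, ‖a m‖ ^ 2 *
        (Real.log m + ∑ n ∈ Finset.Icc 1 (M / m), (Λ n : ℝ) / n) ≤
      Real.log M * ∑ m ∈ Finset.Icc 1 M, ‖a m‖ ^ 2 := by
  rw [Finset.mul_sum]
  refine Finset.sum_le_sum fun m hm ↦ ?_
  rw [mul_comm (Real.log M)]
  exact mul_le_mul_of_nonneg_left (log_add_sum_vonMangoldt_div_le_log hm) (by positivity)

/-- **Stub S4 (`stub_helsonG`) — Helson potential with the constant `39/50`**, registered for line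
`Sketch` of crux stmt-RiemannHypothesis-11229: for every `M`, `a`,
`Σ_m ‖a_m‖² (log m + ψ₁(M/m)) ≤ (log M + 39/50) Σ ‖a_m‖²`. Immediate from the sharp inequality
`sum_norm_sq_mul_potential_le` (constant `0`) since `39/50 · Σ ‖a_m‖² ≥ 0`. [folklore] -/
theorem stub_helsonG : ∀ (M : ℕ) (a : ℕ → ℂ),
    ∑ m ∈ Finset.Icc 1 M, ‖a m‖ ^ 2 *
        (Real.log m +
          ∑ n ∈ Finset.Icc 1 (M / m), (ArithmeticFunction.vonMangoldt n : ℝ) / n) ≤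
      (Real.log M + 39 / 50) * ∑ m ∈ Finset.Icc 1 M, ‖a m‖ ^ 2 := by
  intro M a
  have h := sum_norm_sq_mul_potential_le M a
  have h0 : 0 ≤ ∑ m ∈ Finset.Icc 1 M, ‖a m‖ ^ 2 :=
    Finset.sum_nonneg fun m _ => by positivity
  nlinarith

end Summit.RiemannHypothesis.RiemannHypothesis.Theorems.WeilCombHelsonGK7

end
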